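import Summits.NavierStokesRegularity.FluidComputer.ClayBlowupZoom
import Summits.NavierStokesRegularity.FluidComputer.ClayBlowupSwirlBound
import Summits.NavierStokesRegularity.FluidComputer.PalasekTowerRealisationSwirl
import Summits.NavierStokesRegularity.FluidComputer.ClayBlowupOfBreakdown
import Literature.Analysis.FluidPDE.KNSSRegularityGalileanProofs
import Literature.Analysis.FluidPDE.EulerTimeScaling
import HarnessLib

/-!
# KNSS THEOREM 6.1 WITH THE CLAY FORCE: an axisymmetric Clay blow-up — WITH its (axisymmetric) Clay
# force — escapes the bound `r‖u‖ ≤ C`, and blows up through its POLOIDAL field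

Cell `ns-blowup`, seat `ns-blowup-ecbridge-2` (g10; the E–C endpoint theory seat). LABEL: E–C typing
(KERNEL — no named fact). WHAT THIS IS NOT: not Navier–Stokes evidence — necessary conditions on the
TYPE `ClayBlowup ν` (no inhabitant is claimed anywhere). Companion memo:
`run/shared/lean/pub/ns-blowup/ecbridge2/ECBRIDGE-2-MEMO-9.md`.

## Content

g7/g8 typed KNSS's Theorem 6.1 («an axisymmetric blow-up cannot satisfy `|u| ≤ C/√(x₁² + x₂²)`») only
for the UNFORCED inhabitants of the (C) type (`ClayBlowup.not_typeI_of_isAxisymmetric (hf : X.f = 0)`).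
THE ZOOM WITH FORCE (`ClayBlowup.exists_zoom_limit`, KNSS Prop. 6.1 for a Clay blow-up WITH its Clay
force) removes `hf`: the printed proof of Thm. 6.1 runs verbatim on the zoom limit, which is UNFORCED.

* **`ClayBlowup.not_cylRadius_mul_norm_le_of_isAxisymmetric`** — for EVERY Clay blow-up (`ν > 0`) with
  axisymmetric datum and axisymmetric Clay force: `¬ ∃ C, ∀ t ∈ [0, T), ∀ x, r ‖u(t, x)‖ ≤ C`
  (`r = √(x₁² + x₂²)`). Proof (KNSS 2009, proof of Thm. 6.1, p. 12): normalise `ν = 1`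
  (`ClayBlowup.rescale`; `r‖u‖` is scale invariant); zoom (`exists_zoom_limit`); the near-maxima sit
  at axial distance `≤ C/M_k`, so after a bounded shift `b_k → b` the zooms are axisymmetric about a
  fixed axis and obey `|y'| ‖·‖ ≤ C`; both pass to the locally uniform limit; the shifted limit
  `W(·, · + b)` is a bounded weak solution (translation covariance of the Oseen equation,
  `isBoundedWeakNSSolutionOn_of_oseen`), axisymmetric with `r‖W‖ ≤ C`, hence ZERO by KNSS Thm. 5.3
  (`KNSS2009_liouville_bound_C_over_r_holds`) — against `‖W(0, 0)‖ = 1` and the continuity of `W`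
  at the vertex.
* **`ClayBlowup.poloidal_axisDecay_unbounded_forced`** — hence (g8's forced swirl maximum principle,
  `swirl_bounded`: `r u_θ` IS bounded) the weighted POLOIDAL velocity `r‖ū‖` is unbounded on
  `[0, T) × ℝ³`, WITH the force; kill forms; `DesignedBlowup` / `Realisation` twins; (C)-readings.

References: KNSS, Acta Math. 203 (2009), Thm 5.3, Prop 6.1, Thm 6.1 [cite: KochNadirashviliSereginSverak2009,
Thm 6.1]; Seregin–Šverák, Comm. PDE 34 (2009), §1 (1.2) [cite: SereginSverak2009, §1 (1.2)];
C. L. Fefferman, Clay problem description, (C) [cite: FeffermanClay2006, (C)].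
-/

noncomputable section

namespace Summit.NavierStokesRegularity.FluidComputer

open Set MeasureTheory Filter Topology Function Metric
open scoped ENNReal NNReal
open Literature.Analysis Literature.Analysis.FluidPDE
open Literature.Analysis.FluidPDE.SereginSverak2009
open Summit.NavierStokesRegularity.NavierStokesRegularity

/-! ## §1 Small tools -/

/-- A subsequence of a locally uniformly convergent sequence converges locally uniformly. [folklore] -/
theorem tendstoLocallyUniformly_comp_of_tendsto {α β : Type*} [TopologicalSpace α] [UniformSpace β]
    {F : ℕ → α → β} {f : α → β} (h : TendstoLocallyUniformly F f atTop) {ψ : ℕ → ℕ}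
    (hψ : Tendsto ψ atTop atTop) : TendstoLocallyUniformly (fun j => F (ψ j)) f atTop := by
  intro u hu y
  obtain ⟨s, hs, hev⟩ := h u hu y
  exact ⟨s, hs, hψ.eventually hev⟩

/-- Translation covariance of the caloric extension (local copy of `heatExtension_comp_add_right`,
`KatoSymmetryCovariance.lean`, not imported): `e^{σΔ}(g(· + a))(x) = e^{σΔ}g(x + a)`. [folklore] -/
theorem heatExtension_comp_add_right'' {F : Type*} [NormedAddCommGroup F] [NormedSpace ℝ F]
    (g : EuclideanSpace ℝ (Fin 3) → F) (a : EuclideanSpace ℝ (Fin 3)) (σ : ℝ)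
    (x : EuclideanSpace ℝ (Fin 3)) :
    UnboundedOperators.heatExtension (fun y => g (y + a)) σ x =
      UnboundedOperators.heatExtension g σ (x + a) := by
  simp only [UnboundedOperators.heatExtension_apply]
  refine integral_congr_ae (Eventually.of_forall fun y => ?_)
  simp only [sub_add_eq_add_sub]

namespace ClayBlowup

variable {ν : ℝ} (X : ClayBlowup ν)

/-- The velocity of the viscosity-normalised blow-up `X.rescale hμ hν` is `(ν/μ) • u((ν/μ) t, x)`.
[folklore] -/
theorem rescale_u_apply {μ : ℝ} (Y : ClayBlowup μ) (hμ : 0 < μ) (hν : 0 < ν) (s : ℝ)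
    (y : EuclideanSpace ℝ (Fin 3)) : (Y.rescale hμ hν).u s y = (ν / μ) • Y.u (ν / μ * s) y := rfl

/-- The lifespan of the viscosity-normalised blow-up is `T / (ν/μ)`. [folklore] -/
theorem rescale_T {μ : ℝ} (Y : ClayBlowup μ) (hμ : 0 < μ) (hν : 0 < ν) :
    (Y.rescale hμ hν).T = Y.T / (ν / μ) := rfl

/-! ## §2 KNSS Theorem 6.1 with the Clay force -/

/-- **KNSS THEOREM 6.1 WITH THE CLAY FORCE** (`ν > 0`; no named fact): a Clay blow-up with
axisymmetric datum and axisymmetric Clay force does NOT satisfy `r ‖u(t, x)‖ ≤ C` on `[0, T) × ℝ³`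
for any `C` (`r` the distance to the axis). KNSS 2009's proof of Thm. 6.1 on the zoom WITH force:
normalise the viscosity (`rescale`), zoom at near-maxima (`exists_zoom_limit` — the limit is an
UNFORCED bounded ancient mild solution with `‖W(0,0)‖ = 1`), shift by the bounded rescaled axial
offsets `b_k → b` (`‖b_k‖ = M_k r(x_k) ≤ C`), pass axisymmetry and the scale-invariant bound
`|y'| ‖·‖ ≤ C` to the locally uniform limit, and apply the Liouville theorem
`KNSS2009_liouville_bound_C_over_r_holds` (KNSS Thm. 5.3) to the shifted limit: it vanishes on
`(−∞, 0) × ℝ³`, so `W(0, 0) = 0` by continuity at the vertex — a contradiction. Supersedes the second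
clause of g7's `not_typeI_of_isAxisymmetric` (which needs `X.f = 0`).
[cite: KochNadirashviliSereginSverak2009, Thm 6.1 and its proof (arXiv p. 12), Thm 5.3] -/
theorem not_cylRadius_mul_norm_le_of_isAxisymmetric (hν : 0 < ν) (h0A : IsAxisymmetric (X.u 0))
    (hfA : ∀ t ∈ Ico 0 X.T, IsAxisymmetric (X.f t)) :
    ¬ ∃ C : ℝ, ∀ t ∈ Ico 0 X.T, ∀ x : EuclideanSpace ℝ (Fin 3), cylRadius x * ‖X.u t x‖ ≤ C := by
  rintro ⟨C, hC⟩
  have hax : ∀ t ∈ Ico 0 X.T, IsAxisymmetric (X.u t) := X.isAxisymmetric hν h0A hfA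
  -- ### normalise the viscosity: `Y : ClayBlowup 1`
  set a : ℝ := 1 / ν with ha
  have ha0 : 0 < a := by positivity
  set Y : ClayBlowup 1 := X.rescale hν one_pos with hY
  have hYu : ∀ s y, Y.u s y = a • X.u (a * s) y := fun s y => X.rescale_u_apply hν one_pos s y
  have hYT : Y.T = X.T / a := X.rescale_T hν one_pos
  have hmaps : ∀ s ∈ Ico 0 Y.T, a * s ∈ Ico 0 X.T := by
    intro s hs
    rw [hYT] at hs
    refine ⟨mul_nonneg ha0.le hs.1, ?_⟩
    have := mul_lt_mul_of_pos_left hs.2 ha0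
    rwa [mul_div_cancel₀ _ ha0.ne'] at this
  have hYax : ∀ s ∈ Ico 0 Y.T, IsAxisymmetric (Y.u s) := by
    intro s hs
    have h := (hax (a * s) (hmaps s hs)).const_smul a
    have e : Y.u s = fun y => a • X.u (a * s) y := funext (hYu s)
    rw [e]; exact h
  have hYC : ∀ s ∈ Ico 0 Y.T, ∀ y, cylRadius y * ‖Y.u s y‖ ≤ a * C := by
    intro s hs y
    rw [hYu, norm_smul, Real.norm_eq_abs, abs_of_pos ha0]
    have h := hC (a * s) (hmaps s hs) y
    calc cylRadius y * (a * ‖X.u (a * s) y‖) = a * (cylRadius y * ‖X.u (a * s) y‖) := by ring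
      _ ≤ a * C := mul_le_mul_of_nonneg_left h ha0.le
  -- ### THE ZOOM WITH FORCE
  obtain ⟨t, x, c, φ, W, δ, hφ, hδ, ht, hc, hc01, hk1, hnear, hlife, hWc, hWdiv, hWmild, hW6,
    hW1, hW0, -, -, hconv⟩ := Y.exists_zoom_limit
  have hc0 : ∀ k, 0 < c k := fun k => (hc01 k).1
  -- the rescaled axial offsets `b_k = −c_k⁻¹ (x_k)'`, `‖b_k‖ ≤ a C`
  set b : ℕ → EuclideanSpace ℝ (Fin 3) := fun k => -((c k)⁻¹ • horiz (x k)) with hb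
  have hb_norm : ∀ k, ‖b k‖ ≤ a * C := by
    intro k
    rw [hb]
    simp only [norm_neg]
    rw [norm_inv_smul_horiz (hc0 k), hc, inv_inv, mul_comm]
    exact hYC (t k) ⟨(ht k).1.le, (ht k).2⟩ (x k)
  have hb_axis : ∀ k (y : EuclideanSpace ℝ (Fin 3)),
      x k + c k • (b k + y) = (x k) 2 • eZ + c k • y := by
    intro k y
    rw [hb, smul_add, smul_neg, smul_inv_smul_horiz (hc0 k).ne', ← add_assoc]
    congr 1
    have h := horiz_add_smul_eZ (x k)
    rw [← h]; abel_nf; rw [h]; simp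
  -- a convergent subsequence of the offsets
  obtain ⟨bₒ, -, ψ, hψ, hbψ⟩ := tendsto_subseq_of_bounded (isBounded_closedBall (x := (0 : EuclideanSpace ℝ (Fin 3))) (r := a * C))
    (x := fun j => b (φ j)) (fun j => mem_closedBall_zero_iff.2 (hb_norm (φ j)))
  -- ### the zooms, shifted by `b`, are axis-centred: axisymmetric, with `|y'| ‖·‖ ≤ a C`
  have hzoom_apply : ∀ k s (y : EuclideanSpace ℝ (Fin 3)),
      (c k • stPull (c k ^ 2) (c k) (t k) (x k) Y.u) s (b k + y) =
        c k • Y.u (t k + c k ^ 2 * s) ((x k) 2 • eZ + c k • y) := by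
    intro k s y
    rw [smul_stPull_apply, hb_axis]
  -- the original times of the zoom slices lie in `(0, T)` for `s < δ`, eventually in `k`
  have htime : ∀ s < δ, ∀ᶠ k in atTop, t k + c k ^ 2 * s ∈ Ico 0 Y.T := by
    intro s hs
    rcases le_or_gt 0 s with h0 | h0
    · refine Eventually.of_forall fun k => ⟨?_, ?_⟩
      · have := (ht k).1; positivity
      · nlinarith [hlife k, pow_pos (hc0 k) 2]
    · -- `t_k > T/2` eventually and `c_k² s → 0`
      have hcto : Tendsto c atTop (𝓝 0) := by
        have hMto : Tendsto (fun k => ‖Y.u (t k) (x k)‖) atTop atTop := by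
          refine tendsto_atTop_atTop.2 fun B => ⟨⌈B⌉₊, fun k hk => ?_⟩
          have h1 : (⌈B⌉₊ : ℝ) ≤ k := by exact_mod_cast hk
          linarith [Nat.le_ceil B, hk1 k]
        have h := tendsto_inv_atTop_zero.comp hMto
        refine h.congr fun k => ?_
        simp only [Function.comp, hc k]
      have hc2 : Tendsto (fun k => c k ^ 2 * s) atTop (𝓝 0) := by
        simpa using (hcto.pow 2).mul_const s
      obtain ⟨B₀, hB₀⟩ := Y.exists_norm_le one_pos (half_lt_self Y.T_pos)
      -- `t_k > T/2` for `k` with `M_k > B₀`; and `c_k² s > −T/2` eventually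
      have hev1 : ∀ᶠ k in atTop, -(Y.T / 2) < c k ^ 2 * s :=
        hc2.eventually (lt_mem_nhds (by linarith [Y.T_pos]))
      have hev2 : ∀ᶠ k : ℕ in atTop, B₀ < (k : ℝ) + 1 :=
        (tendsto_atTop_add_const_right _ _ tendsto_natCast_atTop_atTop).eventually
          (eventually_gt_atTop B₀)
      filter_upwards [hev1, hev2] with k hk1' hk2
      have htk : Y.T / 2 < t k := by
        by_contra h
        rw [not_lt] at h
        have := hB₀ (t k) ⟨(ht k).1.le, h⟩ (x k)
        linarith [hk1 k]
      refine ⟨by linarith, ?_⟩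
      have : c k ^ 2 * s < 0 := mul_neg_of_pos_of_neg (pow_pos (hc0 k) 2) h0
      linarith [(ht k).2]
  -- ### the shifted limit `V(s, y) = W(s, y + bₒ)`
  have hWslice : ∀ s < δ, Continuous (W s) := fun s hs =>
    hWc.comp_continuous (Continuous.prodMk_right s) fun y => ⟨hs, mem_univ y⟩
  have hconvψ : ∀ s < δ, TendstoLocallyUniformly
      (fun j => (c (φ (ψ j)) • stPull (c (φ (ψ j)) ^ 2) (c (φ (ψ j))) (t (φ (ψ j))) (x (φ (ψ j))) Y.u) s)
      (W s) atTop := fun s hs => tendstoLocallyUniformly_comp_of_tendsto (hconv s hs) hψ.tendsto_atTop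
  -- pointwise limits at the moving points `b_{φ ψ j} + y → bₒ + y`
  have hlim : ∀ s < δ, ∀ y : EuclideanSpace ℝ (Fin 3), Tendsto
      (fun j => (c (φ (ψ j)) • stPull (c (φ (ψ j)) ^ 2) (c (φ (ψ j))) (t (φ (ψ j))) (x (φ (ψ j))) Y.u) s
        (b (φ (ψ j)) + y)) atTop (𝓝 (W s (bₒ + y))) := by
    intro s hs y
    exact (hconvψ s hs).tendsto_comp (hWslice s hs).continuousAt (hbψ.add tendsto_const_nhds)
  -- (i) axisymmetry of the shifted limit
  have hVax : ∀ s < δ, IsAxisymmetric (fun y => W s (y + bₒ)) := by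
    intro s hs θ y
    simp only
    rw [add_comm (rotZ θ y) bₒ, add_comm y bₒ]
    have h1 := hlim s hs (rotZ θ y)
    have h2 : Tendsto (fun j => rotZ θ ((c (φ (ψ j)) • stPull (c (φ (ψ j)) ^ 2) (c (φ (ψ j)))
        (t (φ (ψ j))) (x (φ (ψ j))) Y.u) s (b (φ (ψ j)) + y))) atTop (𝓝 (rotZ θ (W s (bₒ + y)))) :=
      (continuous_rotZ θ).continuousAt.tendsto.comp (hlim s hs y)
    have hev : ∀ᶠ j in atTop, (c (φ (ψ j)) • stPull (c (φ (ψ j)) ^ 2) (c (φ (ψ j))) (t (φ (ψ j)))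
        (x (φ (ψ j))) Y.u) s (b (φ (ψ j)) + rotZ θ y) =
        rotZ θ ((c (φ (ψ j)) • stPull (c (φ (ψ j)) ^ 2) (c (φ (ψ j))) (t (φ (ψ j))) (x (φ (ψ j))) Y.u) s
          (b (φ (ψ j)) + y)) := by
      have hφψ : Tendsto (fun j => φ (ψ j)) atTop atTop := hφ.tendsto_atTop.comp hψ.tendsto_atTop
      filter_upwards [hφψ.eventually (htime s hs)] with j hj
      rw [hzoom_apply, hzoom_apply]
      exact isAxisymmetric_rescale (hYax _ hj) (c (φ (ψ j))) ((x (φ (ψ j))) 2) (c (φ (ψ j))) θ y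
    exact tendsto_nhds_unique (h1.congr' hev) h2
  -- (ii) the scale-invariant bound of the shifted limit
  have hVC : ∀ s < δ, ∀ y : EuclideanSpace ℝ (Fin 3), cylRadius y * ‖W s (y + bₒ)‖ ≤ a * C := by
    intro s hs y
    rw [add_comm y bₒ]
    have h1 : Tendsto (fun j => cylRadius y * ‖(c (φ (ψ j)) • stPull (c (φ (ψ j)) ^ 2) (c (φ (ψ j)))
        (t (φ (ψ j))) (x (φ (ψ j))) Y.u) s (b (φ (ψ j)) + y)‖) atTop
        (𝓝 (cylRadius y * ‖W s (bₒ + y)‖)) := ((hlim s hs y).norm).const_mul _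
    have hev : ∀ᶠ j in atTop, cylRadius y * ‖(c (φ (ψ j)) • stPull (c (φ (ψ j)) ^ 2) (c (φ (ψ j)))
        (t (φ (ψ j))) (x (φ (ψ j))) Y.u) s (b (φ (ψ j)) + y)‖ ≤ a * C := by
      have hφψ : Tendsto (fun j => φ (ψ j)) atTop atTop := hφ.tendsto_atTop.comp hψ.tendsto_atTop
      filter_upwards [hφψ.eventually (htime s hs)] with j hj
      set k := φ (ψ j) with hk
      rw [hzoom_apply, norm_smul, Real.norm_eq_abs, abs_of_pos (hc0 k)]
      have h := hYC _ hj ((x k) 2 • eZ + c k • y)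
      rw [cylRadius_smul_eZ_add, cylRadius_smul, abs_of_pos (hc0 k)] at h
      calc cylRadius y * (c k * ‖Y.u (t k + c k ^ 2 * s) ((x k) 2 • eZ + c k • y)‖)
          = c k * cylRadius y * ‖Y.u (t k + c k ^ 2 * s) ((x k) 2 • eZ + c k • y)‖ := by ring
        _ ≤ a * C := h
    exact le_of_tendsto h1 hev
  -- (iii) the shifted limit is a bounded weak solution on `ℝ³ × (−∞, 0)`
  have hVcont : ContinuousOn (uncurry fun s y => W s (y + bₒ)) (Iio 0 ×ˢ univ) := by
    have hmap : Continuous fun z : ℝ × EuclideanSpace ℝ (Fin 3) => (z.1, z.2 + bₒ) :=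
      continuous_fst.prodMk (continuous_snd.add continuous_const)
    exact hWc.comp hmap.continuousOn fun z hz => ⟨lt_trans hz.1 hδ, mem_univ _⟩
  have hVweak : IsBoundedWeakNSSolutionOn (Iio 0) isOpen_Iio 1 (fun s y => W s (y + bₒ)) := by
    refine isBoundedWeakNSSolutionOn_of_oseen one_pos hVcont ⟨6, fun s hs y => hW6 s (hs.trans hδ) _⟩
      (fun s hs => (hWdiv s (hs.trans hδ)).comp_add_right' bₒ) fun s τ hsτ hτ y => ?_
    show W τ (y + bₒ) = UnboundedOperators.heatExtension (fun z => W s (z + bₒ)) (1 * (τ - s)) y -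
      oseenDuhamel 1 s (fun σ z => W σ (z + bₒ)) (fun σ z => W σ (z + bₒ)) τ y
    rw [one_mul, oseenDuhamel_comp_add_right 1 s W W bₒ τ y, heatExtension_comp_add_right'',
      hWmild s τ hsτ (hτ.trans hδ) (y + bₒ)]
  -- (iv) Liouville: the shifted limit vanishes on `(−∞, 0) × ℝ³`
  have hzero := KNSS2009_liouville_bound_C_over_r_holds hVweak
    (fun θ => ae_rotZ_of_isAxisymmetric (fun s hs => hVax s (hs.trans hδ)) θ)
    ⟨a * C, ae_cylRadius_mul_norm_le_of_forall fun s hs y => hVC s (hs.trans hδ) y⟩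
  have hslab := ae_eq_zero_slab_of_ae_slice (u := fun s y => W s (y + bₒ))
    (hVcont.aestronglyMeasurable (measurableSet_Iio.prod MeasurableSet.univ)) hzero
  have heqOn : EqOn (uncurry fun s y => W s (y + bₒ)) 0
      (Iio (0 : ℝ) ×ˢ (univ : Set (EuclideanSpace ℝ (Fin 3)))) :=
    Measure.eqOn_open_of_ae_eq hslab (isOpen_Iio.prod isOpen_univ) hVcont continuousOn_const
  have hWneg : ∀ s < 0, W s 0 = 0 := by
    intro s hs
    have h := heqOn (show ((s, -bₒ) : ℝ × EuclideanSpace ℝ (Fin 3)) ∈ Iio 0 ×ˢ univ from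
      ⟨hs, mem_univ _⟩)
    simpa using h
  -- (v) continuity at the vertex: `W(0, 0) = 0`, against `‖W(0, 0)‖ = 1`
  have hcat : ContinuousAt (uncurry W) (0, 0) :=
    hWc.continuousAt ((isOpen_Iio.prod isOpen_univ).mem_nhds ⟨hδ, mem_univ _⟩)
  have hpath : Tendsto (fun s : ℝ => ((s, (0 : EuclideanSpace ℝ (Fin 3))) : ℝ × _)) (𝓝[<] 0)
      (𝓝 (0, 0)) :=
    ((Continuous.prodMk_left 0).tendsto 0).mono_left nhdsWithin_le_nhds
  have hlim0 : Tendsto (fun s : ℝ => W s 0) (𝓝[<] 0) (𝓝 (W 0 0)) := hcat.tendsto.comp hpath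
  have hconst : Tendsto (fun s : ℝ => W s 0) (𝓝[<] 0) (𝓝 0) :=
    tendsto_const_nhds.congr' (eventually_nhdsWithin_of_forall fun s hs => (hWneg s hs).symm)
  have h00 : W 0 0 = 0 := tendsto_nhds_unique hlim0 hconst
  rw [h00, norm_zero] at hW0
  exact zero_ne_one hW0

/-! ## §3 The poloidal reading, WITH the force -/

/-- **AN AXISYMMETRIC CLAY BLOW-UP — WITH ITS CLAY FORCE — HAS UNBOUNDED WEIGHTED POLOIDAL VELOCITY
`r‖ū‖`** (`ν > 0`; no named fact): there is no `C` with `r ‖ū(t, x)‖ ≤ C` on `[0, T) × ℝ³`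
(`ū = poloidalPart u`; Seregin–Šverák's hypothesis (1.2) on the meridional part FAILS). The swirl
`r u_θ` IS bounded WITH the force (g8 `swirl_bounded`, the forced swirl maximum principle), so a bound
on `r‖ū‖` would bound `r‖u‖`, against `not_cylRadius_mul_norm_le_of_isAxisymmetric`. Supersedes g8's
`poloidal_axisDecay_unbounded (hf : X.f = 0)`. [cite: SereginSverak2009, §1 (1.2) and Thm. 1.2]
[cite: KochNadirashviliSereginSverak2009, Thm 6.1] -/
theorem poloidal_axisDecay_unbounded_forced (hν : 0 < ν) (h0A : IsAxisymmetric (X.u 0))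
    (hfA : ∀ t ∈ Ico 0 X.T, IsAxisymmetric (X.f t)) :
    ¬ ∃ C : ℝ, ∀ t ∈ Ico 0 X.T, ∀ x : EuclideanSpace ℝ (Fin 3),
      cylRadius x * ‖poloidalPart (X.u t) x‖ ≤ C := by
  rintro ⟨C, hC⟩
  obtain ⟨CΓ, -, hΓ⟩ := X.swirl_bounded hν h0A hfA
  exact X.not_cylRadius_mul_norm_le_of_isAxisymmetric hν h0A hfA
    ⟨C + CΓ, fun t ht x => cylRadius_mul_norm_le_of_poloidal_of_swirl (hC t ht) (hΓ t ht) x⟩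

/-- **Kill form**: for every `C` there are `t ∈ [0, T)` and `x` with `C < r ‖ū(t, x)‖` — an
axisymmetric Clay blow-up blows up through its POLOIDAL field near the axis, beating `C/r` for every
`C`, WITH its Clay force. [cite: SereginSverak2009, §1 (1.2) and Thm. 1.2] -/
theorem exists_poloidal_axisDecay_gt_forced (hν : 0 < ν) (h0A : IsAxisymmetric (X.u 0))
    (hfA : ∀ t ∈ Ico 0 X.T, IsAxisymmetric (X.f t)) (C : ℝ) :
    ∃ t ∈ Ico 0 X.T, ∃ x : EuclideanSpace ℝ (Fin 3), C < cylRadius x * ‖poloidalPart (X.u t) x‖ := by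
  by_contra h
  push Not at h
  exact X.poloidal_axisDecay_unbounded_forced hν h0A hfA ⟨C, h⟩

end ClayBlowup

/-! ## §4 `DesignedBlowup` twins -/

namespace DesignedBlowup

variable {ν : ℝ} (D : DesignedBlowup ν)

/-- **KNSS Thm 6.1 WITH the force, for designed blow-ups** (`ν > 0`, axisymmetric datum and force).
[cite: KochNadirashviliSereginSverak2009, Thm 6.1] -/
theorem not_cylRadius_mul_norm_le_of_isAxisymmetric (hν : 0 < ν) (h0A : IsAxisymmetric (D.u 0))
    (hfA : ∀ t ∈ Ico 0 D.T, IsAxisymmetric (D.f t)) :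
    ¬ ∃ C : ℝ, ∀ t ∈ Ico 0 D.T, ∀ x : EuclideanSpace ℝ (Fin 3), cylRadius x * ‖D.u t x‖ ≤ C :=
  D.toClayBlowup.not_cylRadius_mul_norm_le_of_isAxisymmetric hν h0A hfA

/-- **Unbounded `r‖ū‖` WITH the force, for designed blow-ups** (`ν > 0`).
[cite: SereginSverak2009, §1 (1.2) and Thm. 1.2] -/
theorem poloidal_axisDecay_unbounded_forced (hν : 0 < ν) (h0A : IsAxisymmetric (D.u 0))
    (hfA : ∀ t ∈ Ico 0 D.T, IsAxisymmetric (D.f t)) :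
    ¬ ∃ C : ℝ, ∀ t ∈ Ico 0 D.T, ∀ x : EuclideanSpace ℝ (Fin 3),
      cylRadius x * ‖poloidalPart (D.u t) x‖ ≤ C :=
  D.toClayBlowup.poloidal_axisDecay_unbounded_forced hν h0A hfA

end DesignedBlowup

/-! ## §5 The tower interface and the (C)-readings -/

namespace PalasekTowerClayBridge.Realisation

variable {ν : ℝ} {R : TowerRates} (W : Realisation ν R)

/-- **An AXISYMMETRIC tower realisation escapes `r‖u‖ ≤ C`, WITH its forcing** (`ν > 0`; datum and
force axisymmetric on `[0, T)`): KNSS Thm 6.1 with the force, through `toDesignedBlowup`.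
[cite: KochNadirashviliSereginSverak2009, Thm 6.1] -/
theorem not_cylRadius_mul_norm_le_of_isAxisymmetric (hν : 0 < ν) (h0A : IsAxisymmetric (W.u 0))
    (hfA : ∀ t ∈ Ico 0 W.T, IsAxisymmetric (W.f t)) :
    ¬ ∃ C : ℝ, ∀ t ∈ Ico 0 W.T, ∀ x : EuclideanSpace ℝ (Fin 3), cylRadius x * ‖W.u t x‖ ≤ C :=
  W.toDesignedBlowup.not_cylRadius_mul_norm_le_of_isAxisymmetric hν h0A hfA

/-- **An axisymmetric tower realisation has unbounded weighted poloidal velocity `r‖ū‖`, WITH its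
forcing** (`ν > 0`). [cite: SereginSverak2009, §1 (1.2) and Thm. 1.2] -/
theorem poloidal_axisDecay_unbounded (hν : 0 < ν) (h0A : IsAxisymmetric (W.u 0))
    (hfA : ∀ t ∈ Ico 0 W.T, IsAxisymmetric (W.f t)) :
    ¬ ∃ C : ℝ, ∀ t ∈ Ico 0 W.T, ∀ x : EuclideanSpace ℝ (Fin 3),
      cylRadius x * ‖poloidalPart (W.u t) x‖ ≤ C :=
  W.toDesignedBlowup.poloidal_axisDecay_unbounded_forced hν h0A hfA

end PalasekTowerClayBridge.Realisation

/-- **(C)-READING OF THE ZOOM WITH FORCE**: if Fefferman's (C) holds, there is a Clay blow-up at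
viscosity `1` whose near-maximum zooms converge, slice-wise locally uniformly, to a KNSS blow-up limit
`W` (smooth bounded ancient mild solution of the UNFORCED equations, `|W| ≤ 1 = ‖W(0,0)‖`) — the
singularity mechanism of any (C)-certificate by blow-up is force-free at the parabolic scale of its
maxima. [cite: KochNadirashviliSereginSverak2009, Prop 6.1] [cite: FeffermanClay2006, (C)] -/
theorem breakdownR3_zoom_limit
    (h : Summit.NavierStokesRegularity.NavierStokesRegularity.NavierStokesBreakdownR3) :
    ∃ (X : ClayBlowup 1) (t : ℕ → ℝ) (x : ℕ → EuclideanSpace ℝ (Fin 3)) (c : ℕ → ℝ) (φ : ℕ → ℕ)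
      (W : ℝ → EuclideanSpace ℝ (Fin 3) → EuclideanSpace ℝ (Fin 3)),
      StrictMono φ ∧ (∀ k, c k = ‖X.u (t k) (x k)‖⁻¹) ∧ (∀ k : ℕ, (k : ℝ) + 1 ≤ ‖X.u (t k) (x k)‖) ∧
      IsKNSSBlowupLimit W ∧ ‖W 0 0‖ = 1 ∧
      ∀ s ≤ 0, TendstoLocallyUniformly
        (fun j => (c (φ j) • stPull (c (φ j) ^ 2) (c (φ j)) (t (φ j)) (x (φ j)) X.u) s) (W s) atTop := by
  obtain ⟨X⟩ := forall_nonempty_clayBlowup_of_breakdownR3 h 1 one_pos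
  obtain ⟨t, x, c, φ, W, δ, hφ, hδ, -, hc, -, hk1, -, -, -, -, -, -, -, hW0, hknss, -, hconv⟩ :=
    X.exists_zoom_limit
  exact ⟨X, t, x, c, φ, W, hφ, hc, hk1, hknss, hW0, fun s hs => hconv s (lt_of_le_of_lt hs hδ)⟩

/-- **(C)-READING OF KNSS THM 6.1 WITH FORCE**: if Fefferman's (C) holds then at every `ν > 0` there is
a Clay blow-up, and whenever its datum and force are axisymmetric it escapes `r‖u‖ ≤ C` for every `C`.
[cite: KochNadirashviliSereginSverak2009, Thm 6.1] [cite: FeffermanClay2006, (C)] -/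
theorem breakdownR3_axisDecay
    (h : Summit.NavierStokesRegularity.NavierStokesRegularity.NavierStokesBreakdownR3) {ν : ℝ}
    (hν : 0 < ν) :
    ∃ X : ClayBlowup ν, IsAxisymmetric (X.u 0) → (∀ t ∈ Ico 0 X.T, IsAxisymmetric (X.f t)) →
      ¬ ∃ C : ℝ, ∀ t ∈ Ico 0 X.T, ∀ x : EuclideanSpace ℝ (Fin 3), cylRadius x * ‖X.u t x‖ ≤ C := by
  obtain ⟨X⟩ := forall_nonempty_clayBlowup_of_breakdownR3 h ν hν
  exact ⟨X, fun h0A hfA => X.not_cylRadius_mul_norm_le_of_isAxisymmetric hν h0A hfA⟩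

end Summit.NavierStokesRegularity.FluidComputer

end
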